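import Summits.HodgeConjecture.HodgeConjecture.Theorems.H413CuspCotTransport
import Summits.HodgeConjecture.HodgeConjecture.Theorems.H413CuspCotTower
import Summits.HodgeConjecture.HodgeConjecture.Theorems.H413TowerConj
import Literature.NumberTheory.Automorphic.UnitaryGroupArchLatticeJunction
import Literature.AlgebraicGeometry.ShimuraVarieties.UnitaryBallCauchyRiemannDictionary
import HarnessLib

/-!
# FLOOR-0 P3, stub S1 — INVERSE GLUING: a level family of `(1,0)`-classes ↦ ONE holomorphic cotangent automorphic form on `U(V)(𝔸_{F⁺})`

Cell hodgecm-mathlib (D-0151), FLOOR 0, crux item H413 = stmt-HodgeConjecture-24833; programme P3 «U3-mult», line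
`Cruxes/H413/Lines/F0_U3CohMultOne.lean` v1.1 (cf02d769), stub `stub_S1_hodgeMatsushimaDecAt` (Matsushima–Hodge realisation of the pin's
`H¹_{B,τ'}(A_∞, ℂ)` by `(1,0) ⊕ (0,1)` cotangent forms — the INVERSE half of P4's class map T2).  Author F0P3-p01 (g0).
`--supports stmt-HodgeConjecture-24833 --as helper`.  Definitions with bodies + theorems; no proof hole, no named fact, no instance.

A-p13 (g21)'s ★ `Theorems/H413CuspCot{Components,Tower,Transport,ClassMap,Pin}` go FORM ↦ CLASSES: a holomorphic cotangent form `F` has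
components `comp F h = (u ↦ F (ιinf u · (1,h)))`, holomorphic weight forms of the conjugate levels, with `(1,0)`-classes `compClass F h`
assembling to `towerFamily F ∈ H_K = towerLevel Γ` (binder-1) and to `clsAt F ∈ H = colim_K H_K`.  THIS FILE goes CLASSES ↦ FORM, the
direction S1 needs, in the currency of the P0 carriers (`Theorems/H413CohFormsCarriers`: `adelicDatum`, `archFactorOf`, `holCotForms`):

* §1 COORDINATES on `U(V)(𝔸_{F⁺})`: `archCoord x = T⁻¹ (x_∞)_{ι₁} T ∈ U(2,1)` (★ `archProjU21EmbCM ∘ archPart`, uniform Sylvester frame) and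
  `finCoord x = x_f` (★ `finPart`); their values on `ιinf u`, `(1,g)`, `K_c` and on rational points (`archCoord γ = toBall γ = ratBall γ`,
  `finCoord γ = γ_f`: ★ `archPart_toAdelic`, `toBall_eq_archProjU21EmbCM`, `finPart_toAdelic`);
* §2 `levelPull Δ : H¹(X_Δ; ℂ) →ₗ weightForms Δ_𝔣 Stab(x₀) (weightOf x₀)` — ★ `classPull` of the ball-quotient datum of `X_Δ` on ALL classes
  (= the pin's `(pinD … Δ hV).pull` on `F¹`, `rfl`): holomorphic (★ `classPull_mem_holWeightForms`), `𝔭`-differentiable (★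
  `mem_holWeightForms_iff_isPHolomorphic_cotangent`), compatible with the rational translates (★ `pull_trPull_apply`), injective on `F¹`;
  and **`glue c x := (levelPull c_{finCoord x}) (archCoord x)`** for a level family `c = (c_h)_h`, linear in `c` (`glueLin`), with
  `glue c (ιinf u · (1,h)) = (levelPull c_h)(u)`;
* §3 for ANY family: the weight along `ιinf ∘ Stab(x₀)`, right `K_c`-invariance, right translation by `(1,g)` = re-indexing, and HOLOMORPHIC GERMS
  along `ιinf` (`isHolGerm_glue`);
* §4 for `c ∈ H_K = towerLevel Γ` with `(1,0)`-components (`c ∈ H10L Γ`, ★ `Theorems/H413TowerConj`): LEFT `U(V)(F⁺)`-INVARIANCE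
  (`glue_toAdelic_mul`: `c_h = t_γ^* c_{γ_f h}` + `pull (t_γ^* cl) = pull cl (γ̃ ·)`), right `Γ.K`-invariance, whence
  **`glue_mem_holCotForms : glue c ∈ holCotForms (archFactorOf F V)`**;
* §5 `eq_zero_of_glue_eq_zero` (injectivity on `(1,0)`-families), `glue_restrictLevel` (change of level is invisible), `glue_translate`
  (`glue (translate g c) = R_g (glue c)`: the binder-1 action is right translation).

The sequel `Theorems/F0P3StubS1Dec.lean` adds the `(0,1)` half by complex conjugation (Hodge decomposition `H¹ = F¹ ⊕ conj F¹` levelwise, ★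
`HodgeStructure.isCompl_F_complexConj 1 1`; ★ `conjL`; P0 `conjFun`), descends to `H = Module.DirectLimit` and closes S1 by name.
HC_CM is proved only modulo the printed citations until rung 0 closes; this file proves nothing about them.
[cite: BorelWallach2000, VII 2.10, VII 3.2, XIII 1.2] [cite: Borel1997, §5.13–5.14] [cite: BorelJacquet1979, §4.1–§4.2] [cite: VoisinHodgeI2002, §7.1.1 Cor. 7.6]

## References
* [BorelWallach2000] A. Borel, N. Wallach, *Continuous cohomology, discrete subgroups, and representations of reductive groups*, 2nd ed., AMS 2000,
  VII 2.10 (Hodge bigrading), VII 3.2 (Matsushima), XIII 1.2 (adelic pieces `⊔_h Γ_h\X`).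
* [Borel1997] A. Borel, *Automorphic forms on SL₂(ℝ)*, CUP 1997, 2.1 (4), §5.13–5.14 (automorphy-factor dictionary, holomorphy).
* [BorelJacquet1979] A. Borel, H. Jacquet, Corvallis PSPM 33.1, §4.1 (`G(𝔸) = G_∞ × G(𝔸_f)`, rational points), §4.2 (right translation, smoothness).
* [VoisinHodgeI2002] C. Voisin, *Hodge Theory and Complex Algebraic Geometry I*, CUP 2002, §7.1.1 Cor. 7.6.
* Tree: ★ `Theorems/H413CuspCot{Components,Tower,Transport}` (A-p13 (g21)), ★ `Theorems/H413TowerConj` (A-p19 (g15): `H10L`), ★ `Theorems/H413CohFormsCarriers`,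
  HodgeCM `Model/AdelicThetaTowerClass` (`pull_trPull_apply`), `Model/AdelicThetaComponents_1` (`pinD`), `Model/TowerLevel_1`, `Model/ThetaHolGerm`;
  ★ `Literature/…/UnitaryBallClassMap` (`classPull`), `UnitaryBallCauchyRiemannDictionary`, `UnitaryGroupAdelicProduct`, `UnitaryGroupArchLatticeJunction`.
-/

set_option autoImplicit false
set_option linter.dupNamespace false

noncomputable section

open MulAction NumberField
open Literature.NumberTheory.Automorphic Literature.NumberTheory.Automorphic.UnitaryGroup
open Literature.Geometry.ComplexHyperbolic.BallModel (U21 x₀)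
open Literature.AlgebraicGeometry.HodgeTheory Literature.AlgebraicGeometry.ShimuraVarieties
open Literature.NumberTheory.Automorphic.PicardCM
open Literature.NumberTheory.Transcendental (Arapura2012_Cor_15_4_6)
open HodgeCM HodgeCM.Model HodgeCM.Model.LevelTranslate HodgeCM.Model.TowerLevel HodgeCM.Model.TowerCarrier
open Summit.HodgeConjecture.HodgeConjecture.Cruxes.H413.CohFormsCarriers
open Summit.HodgeConjecture.HodgeConjecture.Cruxes.H413.TowerConj

namespace Summit.HodgeConjecture.HodgeConjecture.Cruxes.H413.CuspCot

variable (F : HodgeCM.CMField) {ι₁ : F →+* ℂ} (V : HodgeCM.HermSpace3 F ι₁)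

/-! ## §1 Coordinates on `U(V)(𝔸_{F⁺})`: the `ι₁`-archimedean coordinate in `U(2,1)` and the finite-adelic coordinate -/

/-- **The `ι₁`-archimedean coordinate** `x ↦ T⁻¹ (x_∞)_{ι₁} T ∈ U(2,1)` (uniform Sylvester frame `T = V.sylvesterFrame`):
the archimedean part followed by the projection at the place of `ι₁`. [cite: BorelJacquet1979, §4.1] -/
def archCoord : (adelicDatum F V).Adelic →* ↥U21 :=
  (archProjU21EmbCM (HodgeCM.CMField.K F) (HodgeCM.HermSpace3.Hm V) ι₁ V.sylvesterFrame
      (formCongr_eq_of_conjTranspose (HodgeCM.CMField.K F) ι₁ (HodgeCM.HermSpace3.Hm V) V.sylvesterFrame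
        (HodgeCM.Model.sylvesterFrame_J V))).comp
    (archPart (↥(maximalRealSubfield (HodgeCM.CMField.K F))) (HodgeCM.CMField.K F) (IsCMField.complexConj (HodgeCM.CMField.K F)) 3
      (HodgeCM.HermSpace3.Hm V))

/-- **The finite-adelic coordinate** `x ↦ x_f ∈ U(V)(𝔸_{F⁺,f})`. [cite: BorelJacquet1979, §4.1] -/
def finCoord : (adelicDatum F V).Adelic →* ↥(HodgeCM.HermSpace3.adelicFin V) :=
  finPart (↥(maximalRealSubfield (HodgeCM.CMField.K F))) (HodgeCM.CMField.K F) (IsCMField.complexConj (HodgeCM.CMField.K F)) 3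
    (HodgeCM.HermSpace3.Hm V)

variable {F V}

/-- `archCoord (ιinf u) = u`. [cite: BorelJacquet1979, §4.1] -/
@[simp] theorem archCoord_ιinf (u : ↥U21) : archCoord F V ((archFactorOf F V).ιinf u) = u :=
  archProjU21EmbCM_archPart_archSectionU21CM (HodgeCM.CMField.K F) ι₁ (HodgeCM.HermSpace3.Hm V) V.sylvesterFrame
    (HodgeCM.Model.sylvesterFrame_J V) u

/-- `finCoord (ιinf u) = 1`. [cite: BorelJacquet1979, §4.1] -/
@[simp] theorem finCoord_ιinf (u : ↥U21) : finCoord F V ((archFactorOf F V).ιinf u) = 1 := by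
  rw [archFactorOf_ιinf]
  unfold finCoord archSectionU21CM
  rw [archSectionU21Emb_apply, finPart_adelicSingle]

/-- `archCoord (1, g) = 1`. [cite: BorelJacquet1979, §4.1] -/
@[simp] theorem archCoord_finToAdelic (g : ↥(HodgeCM.HermSpace3.adelicFin V)) : archCoord F V (finToAdelic F V g) = 1 := by
  rw [archCoord, MonoidHom.comp_apply]
  change archProjU21EmbCM _ _ _ _ _ (archPart _ _ _ _ _ (finAdelicToAdelic _ _ _ _ _ g)) = 1
  rw [archPart_finAdelicToAdelic, map_one]

/-- `finCoord (1, g) = g`. [cite: BorelJacquet1979, §4.1] -/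
@[simp] theorem finCoord_finToAdelic (g : ↥(HodgeCM.HermSpace3.adelicFin V)) : finCoord F V (finToAdelic F V g) = g :=
  finPart_finAdelicToAdelic _ _ _ _ _ g

/-- `archCoord k = 1` for `k ∈ K_c` (trivial `ι₁`-component). [cite: BorelJacquet1979, §4.1] -/
theorem archCoord_eq_one_of_mem_Kc {k : (adelicDatum F V).Adelic} (hk : k ∈ (archFactorOf F V).Kc) : archCoord F V k = 1 := by
  rw [archFactorOf_Kc] at hk
  obtain ⟨a, ha, rfl⟩ := Subgroup.mem_map.1 hk
  rw [archCoord, MonoidHom.comp_apply]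
  change archProjU21EmbCM _ _ _ _ _ (archPart _ _ _ _ _ (archToAdelic _ _ _ _ _ a)) = 1
  rw [archPart_archToAdelic]
  exact MonoidHom.mem_ker.1 ha

/-- `finCoord k = 1` for `k ∈ K_c` (archimedean). [cite: BorelJacquet1979, §4.1] -/
theorem finCoord_eq_one_of_mem_Kc {k : (adelicDatum F V).Adelic} (hk : k ∈ (archFactorOf F V).Kc) : finCoord F V k = 1 := by
  rw [archFactorOf_Kc] at hk
  obtain ⟨a, -, rfl⟩ := Subgroup.mem_map.1 hk
  exact finPart_archToAdelic _ _ _ _ _ a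

/-- `archCoord (γ) = toBall γ` (`= ratBall γ`) on rational points. [cite: BorelJacquet1979, §4.1] -/
theorem archCoord_toAdelic (γ : ↥(Urat V)) : archCoord F V ((adelicDatum F V).toAdelic γ) = ratBall γ := by
  rw [archCoord, MonoidHom.comp_apply]
  change archProjU21EmbCM _ _ _ _ _ (archPart _ _ _ _ _ (toAdelic _ _ _ _ _ γ)) = _
  rw [archPart_toAdelic]
  exact (toBall_eq_archProjU21EmbCM (HodgeCM.CMField.K F) ι₁ (HodgeCM.HermSpace3.Hm V) V.sylvesterFrame
    (HodgeCM.Model.sylvesterFrame_J V) ⟨(γ : GL (Fin 3) (HodgeCM.CMField.K F)), γ.2⟩).symm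

/-- `finCoord (γ) = (γ)_f` on rational points. [cite: BorelJacquet1979, §4.1] -/
theorem finCoord_toAdelic (γ : ↥(Urat V)) : finCoord F V ((adelicDatum F V).toAdelic γ) = TowerLevel.ρ V γ :=
  finPart_toAdelic _ _ _ _ _ γ

/-! ## §2 The harmonic pull-back at a level, on all classes, and the glued function of a level family -/

section Pin

variable (hHD : exists_isReal_hodgeModel) (hI : hodgePQ_independent_of_hodgeModel)
  (h₁ : BallQuotientUniformised) (h₃ : CMAbelianVarietyRealised) (hA : Arapura2012_Cor_15_4_6)
variable (hV : IsAnisotropic F (HodgeCM.HermSpace3.Hm V))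

/-- **The harmonic pull-back at level `Δ` on ALL classes** `H¹(X_Δ; ℂ) → weightForms Δ_𝔣 Stab(x₀) (weightOf x₀)`: the tree's `classPull`
of the ball-quotient datum of `X_Δ` in the uniform Sylvester frame (the `(1,0)`-part of a class, lifted to the ball and read on `U(2,1)`);
on `F¹` it is the pin's `(pinD … Δ hV).pull` (`levelPull_eq_pinD_pull`, `rfl`). [cite: Borel1997, §5.14] [cite: VoisinHodgeI2002, §7.1.1 Cor. 7.6] -/
abbrev levelPull (Δ : Level V) :
    Coh hHD hI (ballQuotientUniformisedDatum_of h₁) h₃ Δ 1 →ₗ[ℂ]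
      weightForms (levelImage hHD hI h₁ h₃ Δ hV) (stabilizer (↥U21) x₀).subtype
        (BallForms.isPullbackCocycle_cotangentCocycle.weightOf x₀) :=
  (ballDatumOf (hHD := hHD) (hI := hI) (hU := ballQuotientUniformisedDatum_of h₁) (h₃ := h₃) F ι₁ V Δ hV).classPull hHD
    (frameOf hHD hI h₁ h₃ Δ hV)

/-- On `(1,0)`-classes `levelPull` is the pin's `pull`. [cite: Borel1997, §5.14] -/
theorem levelPull_eq_pinD_pull (Δ : Level V) (cl : (pinD hHD hI h₁ h₃ Δ hV).H10) :
    levelPull hHD hI h₁ h₃ hV Δ (cl : (picardCMUniverse hHD hI h₁ h₃).CohC ((picardCMUniverse hHD hI h₁ h₃).pms F ι₁ V Δ) 1) =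
      (pinD hHD hI h₁ h₃ Δ hV).pull cl := rfl

/-- The values of `levelPull` are HOLOMORPHIC weight forms. [cite: Borel1997, §5.14] -/
theorem levelPull_mem_holWeightForms (Δ : Level V) (x : Coh hHD hI (ballQuotientUniformisedDatum_of h₁) h₃ Δ 1) :
    levelPull hHD hI h₁ h₃ hV Δ x ∈
      BallForms.holWeightForms (levelImage hHD hI h₁ h₃ Δ hV) BallForms.isPullbackCocycle_cotangentCocycle :=
  UnitaryBallUniformisationDatum.classPull_mem_holWeightForms _ hHD _ x

/-- The weight of `levelPull`: `f (u · s) = weightOf x₀ s⁻¹ (f u)` for `s ∈ Stab(x₀)`. [cite: Borel1997, §5.14] -/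
theorem levelPull_apply_mul_stabilizer (Δ : Level V) (x : Coh hHD hI (ballQuotientUniformisedDatum_of h₁) h₃ Δ 1)
    (u : ↥U21) (s : ↥(stabilizer (↥U21) x₀)) :
    (levelPull hHD hI h₁ h₃ hV Δ x : ↥U21 → (Fin 2 → ℂ)) (u * s) =
      (BallForms.isPullbackCocycle_cotangentCocycle.weightOf x₀) s⁻¹ ((levelPull hHD hI h₁ h₃ hV Δ x : ↥U21 → (Fin 2 → ℂ)) u) :=
  (levelPull hHD hI h₁ h₃ hV Δ x).2.2 s u

/-- `levelPull` is `ℂ`-differentiable along `𝔭` at every point (holomorphy read through the Cauchy–Riemann dictionary).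
[cite: Borel1997, §5.13–5.14] -/
theorem differentiableAt_pChart_levelPull (Δ : Level V) (x : Coh hHD hI (ballQuotientUniformisedDatum_of h₁) h₃ Δ 1) (u : ↥U21) :
    DifferentiableAt ℂ (BallForms.pChart (levelPull hHD hI h₁ h₃ hV Δ x : ↥U21 → (Fin 2 → ℂ)) u) 0 :=
  (BallForms.mem_holWeightForms_iff_isPHolomorphic_cotangent _).1 (levelPull_mem_holWeightForms hHD hI h₁ h₃ hV Δ x) u

/-- **`t_γ^*` and `levelPull`**: for a `(1,0)`-class `x` of `X_{Δ₂}`, the pull-back of `t_γ^* x` is the left translate `u ↦ (levelPull x)(γ̃ u)`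
(★ `pull_trPull_apply`). [cite: Borel1997, §5.13–5.14] -/
theorem levelPull_trPull_apply {γ : ↥(Urat V)} {Δ₁ Δ₂ : Level V} (ht : TransCond (γ : GL (Fin 3) (HodgeCM.CMField.K F)) Δ₁ Δ₂)
    {x : Coh hHD hI (ballQuotientUniformisedDatum_of h₁) h₃ Δ₂ 1} (hx : x ∈ (pinD hHD hI h₁ h₃ Δ₂ hV).H10) (u : ↥U21) :
    (levelPull hHD hI h₁ h₃ hV Δ₁ (trPull hHD hI (ballQuotientUniformisedDatum_of h₁) h₃ hA γ Δ₁ Δ₂ ht 1 x) : ↥U21 → (Fin 2 → ℂ)) u =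
      (levelPull hHD hI h₁ h₃ hV Δ₂ x : ↥U21 → (Fin 2 → ℂ)) (ratBall γ * u) :=
  pull_trPull_apply hHD hI h₁ h₃ hA hV ht ⟨x, hx⟩ u

/-- Injectivity of `levelPull` on `F¹`. [cite: VoisinHodgeI2002, §7.1.1 Cor. 7.6] -/
theorem eq_zero_of_levelPull_eq_zero {Δ : Level V} {x : Coh hHD hI (ballQuotientUniformisedDatum_of h₁) h₃ Δ 1}
    (hx : x ∈ (pinD hHD hI h₁ h₃ Δ hV).H10) (h0 : (levelPull hHD hI h₁ h₃ hV Δ x : ↥U21 → (Fin 2 → ℂ)) = 0) : x = 0 := by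
  have h := eq_of_pull_eq hHD hI h₁ h₃ hV ⟨x, hx⟩ 0 (by rw [map_zero, Submodule.coe_zero]; exact h0)
  rw [Submodule.coe_zero] at h
  exact h

variable {Γ : Level V} (hΓ : Γ.BelowConjThree)

/-- **THE GLUED FUNCTION of a level family** `c = (c_h)_h`, `c_h ∈ H¹(X_{Γ^h}; ℂ)`: at `x ∈ U(V)(𝔸_{F⁺})` with coordinates `(u, h) = (archCoord x,
finCoord x)`, the value at `u` of the harmonic pull-back of (the `(1,0)`-part of) the class `c_h` of the component of index `h` —
the INVERSE of A-p13's «components» `comp`/`compClass` (★ `Theorems/H413CuspCotComponents`). [cite: BorelWallach2000, XIII 1.2] [cite: Borel1997, §5.14] -/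
def glue (c : Π h : ↥(HodgeCM.HermSpace3.adelicFin V), W hHD hI (ballQuotientUniformisedDatum_of h₁) h₃ Γ hΓ h) :
    (adelicDatum F V).Adelic → (Fin 2 → ℂ) :=
  fun x => (levelPull hHD hI h₁ h₃ hV (Γ.conj (finCoord F V x) hΓ) (c (finCoord F V x)) : ↥U21 → (Fin 2 → ℂ)) (archCoord F V x)

/-- Unfolding `glue`. -/
theorem glue_apply (c : Π h : ↥(HodgeCM.HermSpace3.adelicFin V), W hHD hI (ballQuotientUniformisedDatum_of h₁) h₃ Γ hΓ h)
    (x : (adelicDatum F V).Adelic) :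
    glue hHD hI h₁ h₃ hV hΓ c x =
      (levelPull hHD hI h₁ h₃ hV (Γ.conj (finCoord F V x) hΓ) (c (finCoord F V x)) : ↥U21 → (Fin 2 → ℂ)) (archCoord F V x) := rfl

/-- **Evaluation through coordinates** (crossing the index equality `finCoord x = h` by `subst`). -/
theorem glue_eq_of_coords (c : Π h : ↥(HodgeCM.HermSpace3.adelicFin V), W hHD hI (ballQuotientUniformisedDatum_of h₁) h₃ Γ hΓ h)
    (x : (adelicDatum F V).Adelic) {h : ↥(HodgeCM.HermSpace3.adelicFin V)} {u : ↥U21} (hh : finCoord F V x = h) (hu : archCoord F V x = u) :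
    glue hHD hI h₁ h₃ hV hΓ c x = (levelPull hHD hI h₁ h₃ hV (Γ.conj h hΓ) (c h) : ↥U21 → (Fin 2 → ℂ)) u := by
  subst hh; subst hu; rfl

/-- **`glue c (ιinf u · (1,h)) = (levelPull c_h)(u)`** — the components of the glued function are the pull-backs of the classes.
[cite: BorelWallach2000, XIII 1.2] -/
theorem glue_ιinf_mul_finToAdelic (c : Π h : ↥(HodgeCM.HermSpace3.adelicFin V), W hHD hI (ballQuotientUniformisedDatum_of h₁) h₃ Γ hΓ h)
    (u : ↥U21) (h : ↥(HodgeCM.HermSpace3.adelicFin V)) :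
    glue hHD hI h₁ h₃ hV hΓ c ((archFactorOf F V).ιinf u * finToAdelic F V h) =
      (levelPull hHD hI h₁ h₃ hV (Γ.conj h hΓ) (c h) : ↥U21 → (Fin 2 → ℂ)) u :=
  glue_eq_of_coords hHD hI h₁ h₃ hV hΓ c _ (by rw [map_mul, finCoord_ιinf, finCoord_finToAdelic, one_mul])
    (by rw [map_mul, archCoord_ιinf, archCoord_finToAdelic, mul_one])

/-- `glue` is additive in the family. -/
theorem glue_add (c d : Π h : ↥(HodgeCM.HermSpace3.adelicFin V), W hHD hI (ballQuotientUniformisedDatum_of h₁) h₃ Γ hΓ h) :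
    glue hHD hI h₁ h₃ hV hΓ (c + d) = glue hHD hI h₁ h₃ hV hΓ c + glue hHD hI h₁ h₃ hV hΓ d := by
  funext x
  rw [Pi.add_apply, glue_apply, glue_apply, glue_apply, Pi.add_apply, map_add, Submodule.coe_add, Pi.add_apply]

/-- `glue` is homogeneous in the family. -/
theorem glue_smul (a : ℂ) (c : Π h : ↥(HodgeCM.HermSpace3.adelicFin V), W hHD hI (ballQuotientUniformisedDatum_of h₁) h₃ Γ hΓ h) :
    glue hHD hI h₁ h₃ hV hΓ (a • c) = a • glue hHD hI h₁ h₃ hV hΓ c := by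
  funext x
  rw [Pi.smul_apply, glue_apply, glue_apply, Pi.smul_apply, map_smul, Submodule.coe_smul, Pi.smul_apply]

/-- **`glue` as a `ℂ`-linear map on the level carrier `H_K = towerLevel Γ`.** [cite: BorelWallach2000, XIII 1.2] -/
def glueLin : ↥(towerLevel hHD hI (ballQuotientUniformisedDatum_of h₁) h₃ hA Γ hΓ) →ₗ[ℂ] ((adelicDatum F V).Adelic → (Fin 2 → ℂ)) where
  toFun c := glue hHD hI h₁ h₃ hV hΓ (c : Π h, W hHD hI (ballQuotientUniformisedDatum_of h₁) h₃ Γ hΓ h)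
  map_add' c d := by rw [Submodule.coe_add, glue_add]
  map_smul' a c := by rw [Submodule.coe_smul, glue_smul, RingHom.id_apply]

/-- Unfolding `glueLin`. -/
@[simp] theorem glueLin_apply (c : ↥(towerLevel hHD hI (ballQuotientUniformisedDatum_of h₁) h₃ hA Γ hΓ)) :
    glueLin hHD hI h₁ h₃ hA hV hΓ c = glue hHD hI h₁ h₃ hV hΓ (c : Π h, W hHD hI (ballQuotientUniformisedDatum_of h₁) h₃ Γ hΓ h) := rfl
/-! ## §3 The glued function of ANY family: weight, `K_c`-invariance, right translation, holomorphic germs -/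

/-- **(W) the weight along `ιinf ∘ Stab(x₀)`**: `glue c (x · ιinf s) = weightOf x₀ s⁻¹ (glue c x)`. [cite: Borel1997, §5.14] -/
theorem glue_mul_ιinf_stabilizer (c : Π h : ↥(HodgeCM.HermSpace3.adelicFin V), W hHD hI (ballQuotientUniformisedDatum_of h₁) h₃ Γ hΓ h)
    (x : (adelicDatum F V).Adelic) (s : ↥(stabilizer (↥U21) x₀)) :
    glue hHD hI h₁ h₃ hV hΓ c (x * (archFactorOf F V).ιinf ((stabilizer (↥U21) x₀).subtype s)) =
      (BallForms.isPullbackCocycle_cotangentCocycle.weightOf x₀) s⁻¹ (glue hHD hI h₁ h₃ hV hΓ c x) := by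
  rw [glue_eq_of_coords hHD hI h₁ h₃ hV hΓ c _ (h := finCoord F V x) (u := archCoord F V x * (s : ↥U21))
      (by rw [map_mul, finCoord_ιinf, mul_one]) (by rw [map_mul, archCoord_ιinf, Subgroup.coe_subtype]),
    levelPull_apply_mul_stabilizer, glue_apply]

/-- **(K_c) right invariance under the definite archimedean factor** (both coordinates are blind to `K_c`). [cite: BorelJacquet1979, §4.1] -/
theorem glue_mul_of_mem_Kc (c : Π h : ↥(HodgeCM.HermSpace3.adelicFin V), W hHD hI (ballQuotientUniformisedDatum_of h₁) h₃ Γ hΓ h)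
    (x : (adelicDatum F V).Adelic) {k : (adelicDatum F V).Adelic} (hk : k ∈ (archFactorOf F V).Kc) :
    glue hHD hI h₁ h₃ hV hΓ c (x * k) = glue hHD hI h₁ h₃ hV hΓ c x :=
  glue_eq_of_coords hHD hI h₁ h₃ hV hΓ c _ (by rw [map_mul, finCoord_eq_one_of_mem_Kc hk, mul_one])
    (by rw [map_mul, archCoord_eq_one_of_mem_Kc hk, mul_one])

/-- **Right translation by `(1, g)` re-indexes**: `glue c (x · (1,g)) = (levelPull c_{h g})(u)`, `(u, h)` the coordinates of `x`.
[cite: BorelWallach2000, XIII 1.2] -/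
theorem glue_mul_finToAdelic (c : Π h : ↥(HodgeCM.HermSpace3.adelicFin V), W hHD hI (ballQuotientUniformisedDatum_of h₁) h₃ Γ hΓ h)
    (x : (adelicDatum F V).Adelic) (g : ↥(HodgeCM.HermSpace3.adelicFin V)) :
    glue hHD hI h₁ h₃ hV hΓ c (x * finToAdelic F V g) =
      (levelPull hHD hI h₁ h₃ hV (Γ.conj (finCoord F V x * g) hΓ) (c (finCoord F V x * g)) : ↥U21 → (Fin 2 → ℂ)) (archCoord F V x) :=
  glue_eq_of_coords hHD hI h₁ h₃ hV hΓ c _ (by rw [map_mul, finCoord_finToAdelic]) (by rw [map_mul, archCoord_finToAdelic, mul_one])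

/-- The archimedean probe of `glue c` at `y` is the `𝔭`-chart of the classical form `levelPull c_h` at `u`, `(u, h)` the coordinates of `y`.
[cite: Borel1997, 2.1 (4)] -/
theorem germAt_glue (c : Π h : ↥(HodgeCM.HermSpace3.adelicFin V), W hHD hI (ballQuotientUniformisedDatum_of h₁) h₃ Γ hΓ h)
    (y : (adelicDatum F V).Adelic) :
    germAt (archFactorOf F V).ιinf (glue hHD hI h₁ h₃ hV hΓ c) y =
      BallForms.pChart (levelPull hHD hI h₁ h₃ hV (Γ.conj (finCoord F V y) hΓ) (c (finCoord F V y)) : ↥U21 → (Fin 2 → ℂ))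
        (archCoord F V y) := by
  funext b
  rw [germAt_apply, BallForms.pChart_apply]
  exact glue_eq_of_coords hHD hI h₁ h₃ hV hΓ c _ (by rw [map_mul, finCoord_ιinf, mul_one]) (by rw [map_mul, archCoord_ιinf])

/-- **(H) the glued function has HOLOMORPHIC GERMS along `ιinf`** (the harmonic pull-backs are holomorphic weight forms; Cauchy–Riemann
dictionary ★ `mem_holWeightForms_iff_isPHolomorphic_cotangent`). [cite: BorelWallach2000, VII 2.10] [cite: Borel1997, §5.13–5.14] -/
theorem isHolGerm_glue (c : Π h : ↥(HodgeCM.HermSpace3.adelicFin V), W hHD hI (ballQuotientUniformisedDatum_of h₁) h₃ Γ hΓ h) :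
    IsHolGerm (archFactorOf F V).ιinf (glue hHD hI h₁ h₃ hV hΓ c) := by
  refine ⟨fun y => ?_, fun y v => ?_⟩
  · rw [germAt_glue]
    exact (differentiableAt_pChart_levelPull hHD hI h₁ h₃ hV _ _ _).restrictScalars ℝ
  · rw [germAt_glue]
    have hd := differentiableAt_pChart_levelPull hHD hI h₁ h₃ hV (Γ.conj (finCoord F V y) hΓ) (c (finCoord F V y)) (archCoord F V y)
    rw [hd.fderiv_restrictScalars ℝ]
    simp only [ContinuousLinearMap.coe_restrictScalars', map_smul]

/-! ## §4 The glued function of a `(1,0)`-FAMILY OF THE LEVEL CARRIER `H_K` is a holomorphic cotangent automorphic form -/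

variable {hΓ}

/-- **(L) LEFT INVARIANCE under `U(V)(F⁺)`** for a family `c ∈ H_K = towerLevel Γ` with `(1,0)`-components: the translation identities
`c_h = t_γ^* c_{γ_f h}` of the level carrier, read through ★ `pull_trPull_apply` (`pull (t_γ^* cl) = pull cl (γ̃ ·)`) and the coordinates of
a rational point (`(γ)_{ι₁} = γ̃ = toBall γ`, `(γ)_f = γ_f`). [cite: BorelWallach2000, XIII 1.2] [cite: BorelJacquet1979, §4.1] -/
theorem glue_toAdelic_mul (c : ↥(towerLevel hHD hI (ballQuotientUniformisedDatum_of h₁) h₃ hA Γ hΓ))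
    (hc : c ∈ H10L hHD hI (ballQuotientUniformisedDatum_of h₁) h₃ hA Γ hΓ) (γ : ↥(Urat V)) (x : (adelicDatum F V).Adelic) :
    glue hHD hI h₁ h₃ hV hΓ (c : Π h, W hHD hI (ballQuotientUniformisedDatum_of h₁) h₃ Γ hΓ h) ((adelicDatum F V).toAdelic γ * x) =
      glue hHD hI h₁ h₃ hV hΓ (c : Π h, W hHD hI (ballQuotientUniformisedDatum_of h₁) h₃ Γ hΓ h) x := by
  rw [mem_H10L_iff] at hc
  rw [glue_eq_of_coords hHD hI h₁ h₃ hV hΓ _ _ (h := TowerLevel.ρ V γ * finCoord F V x) (u := ratBall γ * archCoord F V x)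
      (by rw [map_mul, finCoord_toAdelic]) (by rw [map_mul, archCoord_toAdelic]),
    glue_apply, apply_eq_trPull hHD hI (ballQuotientUniformisedDatum_of h₁) h₃ hA c (Rel.self γ (finCoord F V x))
      (transCond_of_rel hΓ (Rel.self γ (finCoord F V x))),
    levelPull_trPull_apply hHD hI h₁ h₃ hA hV _ (hc _)]

/-- **Right invariance under the level `K`** for `c ∈ H_K` with `(1,0)`-components (`c_h = t_1^* c_{h k}`). [cite: BorelJacquet1979, §4.2] -/
theorem glue_mul_finToAdelic_of_mem (c : ↥(towerLevel hHD hI (ballQuotientUniformisedDatum_of h₁) h₃ hA Γ hΓ))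
    (hc : c ∈ H10L hHD hI (ballQuotientUniformisedDatum_of h₁) h₃ hA Γ hΓ) (x : (adelicDatum F V).Adelic)
    {k : ↥(HodgeCM.HermSpace3.adelicFin V)} (hk : k ∈ Γ.K) :
    glue hHD hI h₁ h₃ hV hΓ (c : Π h, W hHD hI (ballQuotientUniformisedDatum_of h₁) h₃ Γ hΓ h) (x * finToAdelic F V k) =
      glue hHD hI h₁ h₃ hV hΓ (c : Π h, W hHD hI (ballQuotientUniformisedDatum_of h₁) h₃ Γ hΓ h) x := by
  rw [mem_H10L_iff] at hc
  rw [glue_mul_finToAdelic, glue_apply,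
    apply_eq_trPull hHD hI (ballQuotientUniformisedDatum_of h₁) h₃ hA c (Rel.one_of_mem (h := finCoord F V x) hk)
      (transCond_of_rel hΓ (Rel.one_of_mem (h := finCoord F V x) hk)),
    levelPull_trPull_apply hHD hI h₁ h₃ hA hV _ (hc _), ratBall_one, one_mul]

/-- **THE GLUED FUNCTION IS A HOLOMORPHIC COTANGENT AUTOMORPHIC FORM for the factor of record**: `glue c ∈ holCotForms (archFactorOf F V)`
for every `c ∈ H_K` with `(1,0)`-components ((L) `glue_toAdelic_mul`, (W) `glue_mul_ιinf_stabilizer`, (K_c) `glue_mul_of_mem_Kc`, smooth =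
fixed by the open `Γ.K` (`glue_mul_finToAdelic_of_mem`), (H) `isHolGerm_glue`). [cite: Borel1997, §5.14] [cite: BorelWallach2000, VII 2.10; XIII 1.2]
[cite: BorelJacquet1979, §4.1–§4.2] -/
theorem glue_mem_holCotForms (c : ↥(towerLevel hHD hI (ballQuotientUniformisedDatum_of h₁) h₃ hA Γ hΓ))
    (hc : c ∈ H10L hHD hI (ballQuotientUniformisedDatum_of h₁) h₃ hA Γ hΓ) :
    glue hHD hI h₁ h₃ hV hΓ (c : Π h, W hHD hI (ballQuotientUniformisedDatum_of h₁) h₃ Γ hΓ h) ∈ holCotForms (archFactorOf F V) := by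
  refine ⟨⟨⟨⟨fun γ hγ x => ?_, fun s x => ?_⟩, fun k hk x => ?_⟩, ?_⟩, ?_⟩
  · -- (L)
    obtain ⟨g, rfl⟩ := hγ
    exact glue_toAdelic_mul hHD hI h₁ h₃ hA hV c hc g x
  · -- (W)
    exact glue_mul_ιinf_stabilizer hHD hI h₁ h₃ hV hΓ _ x s
  · -- (K_c)
    exact glue_mul_of_mem_Kc hHD hI h₁ h₃ hV hΓ _ x hk
  · -- smooth: fixed by the open level `Γ.K`
    refine Submodule.mem_iSup_of_mem Γ.K (Submodule.mem_iSup_of_mem Γ.isOpen_K ?_)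
    refine (Representation.mem_invariants _ _).2 fun k => ?_
    funext x
    exact glue_mul_finToAdelic_of_mem hHD hI h₁ h₃ hA hV c hc x k.2
  · -- (H)
    exact isHolGerm_glue hHD hI h₁ h₃ hV hΓ _

/-- The glued form is fixed by `rightRep k`, `k ∈ Γ.K`. [cite: BorelJacquet1979, §4.2] -/
theorem rightRep_glue_of_mem (c : ↥(towerLevel hHD hI (ballQuotientUniformisedDatum_of h₁) h₃ hA Γ hΓ))
    (hc : c ∈ H10L hHD hI (ballQuotientUniformisedDatum_of h₁) h₃ hA Γ hΓ) {k : ↥(HodgeCM.HermSpace3.adelicFin V)} (hk : k ∈ Γ.K) :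
    rightRep F V k (glue hHD hI h₁ h₃ hV hΓ (c : Π h, W hHD hI (ballQuotientUniformisedDatum_of h₁) h₃ Γ hΓ h)) =
      glue hHD hI h₁ h₃ hV hΓ (c : Π h, W hHD hI (ballQuotientUniformisedDatum_of h₁) h₃ Γ hΓ h) :=
  funext fun x => glue_mul_finToAdelic_of_mem hHD hI h₁ h₃ hA hV c hc x hk

/-! ## §5 Injectivity, change of level, and equivariance of the gluing -/

/-- **The components of the glued form are recovered at `ιinf u · (1, h)`; hence `glue c = 0 ⇒ c = 0`** for `(1,0)`-families
(injectivity of the level class maps ★ `classMapDatumOf_pull_injective`). [cite: VoisinHodgeI2002, §7.1.1 Cor. 7.6] -/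
theorem eq_zero_of_glue_eq_zero (c : ↥(towerLevel hHD hI (ballQuotientUniformisedDatum_of h₁) h₃ hA Γ hΓ))
    (hc : c ∈ H10L hHD hI (ballQuotientUniformisedDatum_of h₁) h₃ hA Γ hΓ)
    (h0 : glue hHD hI h₁ h₃ hV hΓ (c : Π h, W hHD hI (ballQuotientUniformisedDatum_of h₁) h₃ Γ hΓ h) = 0) : c = 0 := by
  rw [mem_H10L_iff] at hc
  apply Subtype.ext
  funext h
  rw [Submodule.coe_zero, Pi.zero_apply]
  refine eq_zero_of_levelPull_eq_zero hHD hI h₁ h₃ hV (hc h) (funext fun u => ?_)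
  rw [← glue_ιinf_mul_finToAdelic hHD hI h₁ h₃ hV hΓ, h0]
  rfl

/-- **Change of level**: `glue (restrictLevel c) = glue c` (`Γ' ≤ Γ`; the components of `restrictLevel c` are `t_1^* c_h`).
[cite: BorelWallach2000, XIII 1.2] -/
theorem glue_restrictLevel {Γ Γ' : Level V} (hle : Γ' ≤ Γ) (hΓ : Γ.BelowConjThree) (hΓ' : Γ'.BelowConjThree)
    (c : ↥(towerLevel hHD hI (ballQuotientUniformisedDatum_of h₁) h₃ hA Γ hΓ))
    (hc : c ∈ H10L hHD hI (ballQuotientUniformisedDatum_of h₁) h₃ hA Γ hΓ) :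
    glue hHD hI h₁ h₃ hV hΓ' (restrictLevel hHD hI (ballQuotientUniformisedDatum_of h₁) h₃ hA hle hΓ hΓ' c :
        Π h, W hHD hI (ballQuotientUniformisedDatum_of h₁) h₃ Γ' hΓ' h) =
      glue hHD hI h₁ h₃ hV hΓ (c : Π h, W hHD hI (ballQuotientUniformisedDatum_of h₁) h₃ Γ hΓ h) := by
  rw [mem_H10L_iff] at hc
  funext x
  rw [glue_apply, glue_apply, restrictLevel_apply, levelPull_trPull_apply hHD hI h₁ h₃ hA hV _ (hc _), ratBall_one, one_mul]

/-- **Equivariance**: `glue (translate g c) = R_g (glue c)` — re-indexing the family is right translation by `(1, g)`.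
[cite: BorelWallach2000, XIII 1.2] [cite: BorelJacquet1979, §4.2] -/
theorem glue_translate (hΓ : Γ.BelowConjThree) (g : ↥(HodgeCM.HermSpace3.adelicFin V))
    (c : ↥(towerLevel hHD hI (ballQuotientUniformisedDatum_of h₁) h₃ hA Γ hΓ))
    (hc : c ∈ H10L hHD hI (ballQuotientUniformisedDatum_of h₁) h₃ hA Γ hΓ) :
    glue hHD hI h₁ h₃ hV (hΓ.conj g) (translate hHD hI (ballQuotientUniformisedDatum_of h₁) h₃ hA hΓ g c :
        Π h, W hHD hI (ballQuotientUniformisedDatum_of h₁) h₃ (Γ.conj g hΓ) (hΓ.conj g) h) =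
      rightRep F V g (glue hHD hI h₁ h₃ hV hΓ (c : Π h, W hHD hI (ballQuotientUniformisedDatum_of h₁) h₃ Γ hΓ h)) := by
  rw [mem_H10L_iff] at hc
  funext x
  show _ = glue hHD hI h₁ h₃ hV hΓ (c : Π h, W hHD hI (ballQuotientUniformisedDatum_of h₁) h₃ Γ hΓ h) (x * finToAdelic F V g)
  rw [glue_apply, translate_apply, levelPull_trPull_apply hHD hI h₁ h₃ hA hV _ (hc _), ratBall_one, one_mul, glue_mul_finToAdelic]

end Pin

end Summit.HodgeConjecture.HodgeConjecture.Cruxes.H413.CuspCot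

end
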